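import Mathlib
import HarnessLib
import Literature.MathematicalPhysics.QuantumLattice.GrassmannFlowGeometricMajorants
import Literature.MathematicalPhysics.QuantumLattice.HubbardGridFlowParameters
import Literature.MathematicalPhysics.QuantumLattice.HubbardGridCounterQuadratic

/-!
# Scalar kit for the β′ rate arithmetic: closed forms and majorants of the weighted-step profiles

Three scalar facts used to feed the majorant doors (`…ResponseMaj`, `…ScaleZeroLegMaj`) with VOLUME-UNIFORM closed forms:

* `normV_bareGridVertex` — at the bare frame the grid vertex profile has `normV = (e²(κ+ρ))⁴·(|U||β|/N)` exactly
  (the counterterm slot vanishes: `Ǩ_L(0) = 0`);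
* `normV_geometricProfile_le` — for the step OUTPUT profile `Nw m′ = ρ₀^{-2m′}·P`: `normV(κ, ρ, Nw) ≤ P/(1 − (e²(κ+ρ)/ρ₀)²)`
  (`e²(κ+ρ) < ρ₀`), uniformly in the label type;
* `stepBound_mono` — `ρ⁻ᵐ·e·x/(1 − e·α·x/κ²)` is monotone in `x` below the smallness threshold, so majorising `normV` majorises
  the weighted-step output.
-/

namespace Summit.HubbardSuperconductivity.HubbardSuperconductivity.Theorems.TwoVolumeDefect

open Finset Literature.MathematicalPhysics.QuantumLattice Literature.Probability.LatticeModels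

/-- **The bare grid vertex profile in closed form**: with `Nv 1 = (|β|/N)·Σ_z ‖Ǩ_L(0)(z)‖(1+|z|) = 0` and `Nv 2 = |U||β|/N`,
`normV(κ, ρ, Nv) = (e²(κ+ρ))⁴·(|U||β|/N)` (`4 ≤ |Γ|`, true on every grid). -/
theorem normV_bareGridVertex {L N : ℕ} [NeZero L] [NeZero N] (κ ρ β U : ℝ) :
    normV (GridLeg (GridPoint L N)) κ ρ
        (fun m' : ℕ => if m' = 1 then |β| / N * ∑ z : TorusSite 2 L, ‖framePosKernel L (0 : TrigPolyC4v) z‖ * (1 + torusSiteDist z 0)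
          else if m' = 2 then |U| * |β| / N else 0) =
      (Real.exp 2 * (κ + ρ)) ^ 4 * (|U| * |β| / N) := by
  have hker : ∀ z : TorusSite 2 L, framePosKernel L (0 : TrigPolyC4v) z = 0 := fun z => by
    rw [framePosKernel]; simp [TrigPolyC4v.eval_zero]
  have hcard := four_le_card_gridLeg (L := L) (N := N)
  unfold normV
  have h2 : 2 ∈ range (Fintype.card (GridLeg (GridPoint L N)) / 2 + 1) := mem_range.2 (by omega)
  rw [Finset.sum_eq_single_of_mem 2 h2]
  · simp
  · intro m _ hne
    by_cases h1 : m = 1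
    · subst h1; simp [hker]
    · simp only [if_neg h1, if_neg hne, mul_zero]

/-- **The geometric output profile has a volume-uniform `normV`**: for `Nw m′ = ρ₀⁻¹^(2m′)·P` (`P ≥ 0`, `ρ₀ > 0`,
`e²(κ+ρ)·ρ₀⁻¹ < 1`, `0 ≤ κ + ρ`), `normV Γ κ ρ Nw ≤ P / (1 − (e²(κ+ρ)ρ₀⁻¹)²)` for EVERY finite label type `Γ`. -/
theorem normV_geometricProfile_le {Γ : Type*} [Fintype Γ] {κ ρ ρ₀ P : ℝ} (hκρ : 0 ≤ κ + ρ) (hρ₀ : 0 < ρ₀) (hP : 0 ≤ P)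
    (hq : Real.exp 2 * (κ + ρ) * ρ₀⁻¹ < 1) :
    normV Γ κ ρ (fun m' : ℕ => ρ₀⁻¹ ^ (2 * m') * P) ≤ P / (1 - (Real.exp 2 * (κ + ρ) * ρ₀⁻¹) ^ 2) := by
  have h := normV_geometric_le (Γ := Γ) hκρ (inv_nonneg.2 hρ₀.le) hP hq
  have hfun : (fun m' : ℕ => ρ₀⁻¹ ^ (2 * m') * P) = fun m' : ℕ => P * ρ₀⁻¹ ^ (2 * m') := funext fun m' => mul_comm _ _
  rw [hfun]
  exact h

/-- **Monotonicity of the weighted-step output in the vertex size**: if `0 ≤ x ≤ x̄`, `0 ≤ α`, `0 < κ`, `0 < ρ` and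
`e·α·x̄/κ² < 1`, then `ρ⁻ᵐ·e·x/(1 − e·α·x/κ²) ≤ ρ⁻ᵐ·e·x̄/(1 − e·α·x̄/κ²)`. -/
theorem stepBound_mono {x xb α κ ρ : ℝ} (hx : 0 ≤ x) (hxb : x ≤ xb) (hα : 0 ≤ α) (hκ : 0 < κ) (hρ : 0 < ρ)
    (hθ : Real.exp 1 * α * xb / κ ^ 2 < 1) (m : ℕ) :
    ρ⁻¹ ^ m * (Real.exp 1 * x) / (1 - Real.exp 1 * α * x / κ ^ 2) ≤ ρ⁻¹ ^ m * (Real.exp 1 * xb) / (1 - Real.exp 1 * α * xb / κ ^ 2) := by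
  have he : 0 < Real.exp 1 := Real.exp_pos 1
  have hθx : Real.exp 1 * α * x / κ ^ 2 ≤ Real.exp 1 * α * xb / κ ^ 2 := by gcongr
  have h1 : 0 < 1 - Real.exp 1 * α * xb / κ ^ 2 := by linarith
  have h2 : 0 < 1 - Real.exp 1 * α * x / κ ^ 2 := by linarith
  rw [div_le_div_iff₀ h2 h1]
  have hxb0 : 0 ≤ xb := hx.trans hxb
  have hnum : ρ⁻¹ ^ m * (Real.exp 1 * x) ≤ ρ⁻¹ ^ m * (Real.exp 1 * xb) := by gcongr
  have hA : 0 ≤ ρ⁻¹ ^ m * (Real.exp 1 * x) := by positivity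
  have hB : 0 ≤ ρ⁻¹ ^ m * (Real.exp 1 * xb) := by positivity
  nlinarith [mul_le_mul_of_nonneg_left hθx hB, mul_le_mul_of_nonneg_right hnum h1.le]

/-- The smallness transfers to the majorant: `e·α·x/κ² ≤ e·α·x̄/κ²`. -/
theorem theta_mono {x xb α κ : ℝ} (hxb : x ≤ xb) (hα : 0 ≤ α) :
    Real.exp 1 * α * x / κ ^ 2 ≤ Real.exp 1 * α * xb / κ ^ 2 := by
  have he : 0 < Real.exp 1 := Real.exp_pos 1
  gcongr

end Summit.HubbardSuperconductivity.HubbardSuperconductivity.Theorems.TwoVolumeDefect
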